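/-
Copyright (c) 2026. All rights reserved.
Released under Apache 2.0 license as described in the file LICENSE.
-/
import Mathlib
import HarnessLib
import Literature.Topology.FourManifolds.CobordismEndLevelsDiffeo

/-!
# The low levels of a cobordism: the diffeomorphism with the incoming end is homotopic to the
# boundary inclusion

Topic `Literature/Topology/FourManifolds`. Module B1 of the proof of
`Literature.Topology.FourManifolds.exists_middleLevel_isStabilization_of_isHCobordism` (Kirby 1989,
Ch. X pp. 55–56): to compare 2-spheres in the interior of an h-cobordism with 2-spheres of its
incoming end one needs, besides the diffeomorphism `M ≃ₘ V` of the end with a low level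
(`Cobordism.IsMorseFunction.exists_pos_nonempty_diffeomorph_level`, `CobordismEndLevelsDiffeo.lean`),
that the resulting embedding `M → W` is homotopic to the boundary inclusion `inl`.  This file
re-runs that proof (Milnor 1965, Thm. 3.4 / Cor. 3.5: the flow-out `x ↦ Fl (inl x) e` of the
boundary-defining function) and records the homotopy `(s, x) ↦ Fl (inl x) (s e)`
(`Cobordism.IsMorseFunction.exists_pos_diffeomorph_level_homotopic`).  Everything is proved; no
definitions, no named facts.

## References

* J. Milnor, *Lectures on the h-cobordism theorem* (1965), Thm. 3.4 and its proof, Cor. 3.5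
  (PDF pp. 12–13). [MilnorHCobordism1965]
* R. C. Kirby, *The topology of 4-manifolds*, LNM 1374 (1989), Ch. X, pp. 55–56. [Kirby1989]
-/

open scoped Manifold ContDiff Topology
open Set Function Filter Metric

noncomputable section

namespace Literature.Topology.FourManifolds

universe u

variable {n : ℕ} {M N : Type u} [TopologicalSpace M] [ChartedSpace (EuclideanSpace ℝ (Fin n)) M]
  [TopologicalSpace N] [ChartedSpace (EuclideanSpace ℝ (Fin n)) N]

namespace Cobordism

/-- **Milnor 1965, Thm. 3.4 / Cor. 3.5, with the homotopy: the levels near the incoming end are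
diffeomorphic to it, by a diffeomorphism whose composite with the level embedding is homotopic to
the boundary inclusion.**  For a Morse function `f` on a cobordism `(W; M, N)` there is `ε₀ > 0`
such that for every `0 < ε ≤ ε₀` and every smooth manifold `V` smoothly embedded by `ι` onto the
level `f⁻¹(ε)` there is `φ : M ≃ₘ V` with `inl ≃ ι ∘ φ` as maps `M → W` (the flow-out
`(s, x) ↦ Fl (inl x) (s e)`). [cite: MilnorHCobordism1965, Thm. 3.4 and its proof, Cor. 3.5 (PDF pp. 12–13)] -/
theorem IsMorseFunction.exists_pos_diffeomorph_level_homotopic [IsManifold (𝓡 n) ∞ M]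
    {c : Cobordism n M N} {f : c.W → ℝ} (hf : c.IsMorseFunction f) :
    ∃ ε₀ : ℝ, 0 < ε₀ ∧ ∀ ε, 0 < ε → ε ≤ ε₀ →
      ∀ (V : Type u) [TopologicalSpace V] [ChartedSpace (EuclideanSpace ℝ (Fin n)) V]
        [IsManifold (𝓡 n) ∞ V] (ι : V → c.W) (hι : Manifold.IsSmoothEmbedding (𝓡 n) (𝓡∂ (n + 1)) ∞ ι),
        range ι = f ⁻¹' {ε} →
          ∃ φ : M ≃ₘ⟮𝓡 n, 𝓡 n⟯ V,
            (⟨c.inl, c.isSmoothEmbedding_inl.isEmbedding.continuous⟩ : C(M, c.W)).Homotopic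
              ⟨ι ∘ φ, hι.isEmbedding.continuous.comp φ.continuous⟩ := by
  classical
  obtain ⟨D, hD⟩ := hf.exists_flowoutInput
  set Γ : D.Cover := Classical.choice D.nonempty_cover with hΓ
  have ha := Γ.a_pos
  have hfs : ContMDiff (𝓡∂ (n + 1)) 𝓘(ℝ, ℝ) ∞ f := hf.isMorse.contMDiff
  have hfc : Continuous f := hfs.continuous
  have hgc : Continuous D.f := D.f_smooth.continuous
  refine ⟨min (Γ.a / 2) (1 / 8), by positivity, fun ε hε hεε₀ V _ _ _ ι hι hrange => ?_⟩
  have hεa : ε ≤ Γ.a / 2 := hεε₀.trans (min_le_left _ _)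
  have hε8 : ε ≤ 1 / 8 := hεε₀.trans (min_le_right _ _)
  set e : ℝ := ε * (1 - ε) with he_def
  have he0 : 0 < e := mul_pos hε (by linarith)
  have heε : e ≤ ε := by rw [he_def]; nlinarith
  have hea : e < Γ.a := by linarith
  have he4 : e < 1 / 4 := by linarith
  -- along a flow-out curve `f` does not cross `1/2` while `g < 1/4`
  have stay : ∀ z, D.f z ≤ Γ.a → f z < 1 / 2 → D.f z < 1 / 4 → ∀ {T : ℝ}, T ∈ Icc (-D.f z) Γ.a →
      D.f z + T < 1 / 4 → f (Γ.Fl z T) < 1 / 2 := by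
    intro z hz hfz hz4 T hT hT4
    by_contra hge
    push Not at hge
    have hsub : uIcc 0 T ⊆ Icc (-D.f z) Γ.a := by
      rcases le_total 0 T with h | h
      · rw [uIcc_of_le h]; exact Icc_subset_Icc (by linarith [D.f_nonneg z]) hT.2
      · rw [uIcc_of_ge h]; exact Icc_subset_Icc hT.1 ha.le
    have hcont : ContinuousOn (fun s => f (Γ.Fl z s)) (uIcc 0 T) :=
      hfc.comp_continuousOn ((Γ.isMIntegralCurveOn_Fl hz).continuousOn.mono hsub)
    have h0 : f (Γ.Fl z 0) = f z := by rw [Γ.Fl_zero hz]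
    have hmem : (1 / 2 : ℝ) ∈ uIcc (f (Γ.Fl z 0)) (f (Γ.Fl z T)) := by
      rw [h0, uIcc_of_le (hfz.le.trans hge)]; exact ⟨hfz.le, hge⟩
    obtain ⟨s, hs, hfs'⟩ := intermediate_value_uIcc hcont hmem
    have hgs : D.f (Γ.Fl z s) = D.f z + s := Γ.f_Fl hz (hsub hs)
    have hfs'' : f (Γ.Fl z s) = 1 / 2 := hfs'
    have hval : D.f (Γ.Fl z s) = 1 / 4 := by rw [hD, hfs'']; norm_num
    have hlt : D.f z + s < 1 / 4 := by
      rcases le_total 0 T with h | h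
      · rw [uIcc_of_le h] at hs; linarith [hs.2]
      · rw [uIcc_of_ge h] at hs; linarith [hs.2]
    linarith
  -- values of `f` and `g` on `inl M` and on the level
  have hg_inl : ∀ x, D.f (c.inl x) = 0 := fun x => by rw [hD, hf.2.1 x, zero_mul]
  have hg_lev : ∀ w : c.W, f w = ε → D.f w = e := fun w hw => by rw [hD, hw]
  have hFl_lev : ∀ x, f (Γ.Fl (c.inl x) e) = ε := by
    intro x
    have hz : D.f (c.inl x) ≤ Γ.a := by rw [hg_inl]; exact ha.le
    have heI : e ∈ Icc (-D.f (c.inl x)) Γ.a := by rw [hg_inl, neg_zero]; exact ⟨he0.le, hea.le⟩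
    have hhalf : f (Γ.Fl (c.inl x) e) < 1 / 2 :=
      stay _ hz (by rw [hf.2.1 x]; norm_num) (by rw [hg_inl]; norm_num) heI (by rw [hg_inl]; linarith)
    have hge : D.f (Γ.Fl (c.inl x) e) = e := by rw [Γ.f_Fl hz heI, hg_inl, zero_add]
    rw [hD] at hge
    exact eq_of_mul_one_sub_eq hge hhalf (by linarith)
  have hret_mem : ∀ w : c.W, f w = ε → Γ.ret w ∈ range c.inl := by
    intro w hw
    have hgw := hg_lev w hw
    have hwa : D.f w ≤ Γ.a := by rw [hgw]; exact hea.le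
    have hb : Γ.ret w ∈ (𝓡∂ (n + 1)).boundary c.W := Γ.ret_mem_boundary hwa
    have hhalf : f (Γ.ret w) < 1 / 2 := by
      change f (Γ.Fl w (-D.f w)) < 1 / 2
      refine stay w hwa (by rw [hw]; linarith) (by rw [hgw]; exact he4) ⟨le_rfl, ?_⟩ (by norm_num)
      linarith [D.f_nonneg w]
    rw [← c.range_inl_union_range_inr] at hb
    rcases hb with h | ⟨y, hy⟩
    · exact h
    · exfalso
      rw [← hy, hf.2.2.1 y] at hhalf
      norm_num at hhalf
  ----------------------------------------------------------------------------------------------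
  -- smoothness of the flow-out at height `e` near `inl M`, and of the retraction near the level
  ----------------------------------------------------------------------------------------------
  have hsm_Fl : ∀ x, ContMDiffAt (𝓡∂ (n + 1)) (𝓡∂ (n + 1)) ∞ (fun z => Γ.Fl z e) (c.inl x) := by
    intro x
    set z₀ := c.inl x
    have hz₀ : D.f z₀ = 0 := hg_inl x
    have hz₀a : D.f z₀ ≤ Γ.a := by rw [hz₀]; exact ha.le
    obtain ⟨hy, hzd⟩ := Γ.centre_spec hz₀a
    set C := Γ.bx (Γ.centre z₀) hy with hC
    have hεbox : e ≤ C.box.ε := hea.le.trans (Γ.a_le_ε _ hy)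
    -- the open set of points of the box domain with `g < a - e` (so that `e ≤ a - g`)
    set O : Set c.W := C.dom ∩ {z | D.f z < Γ.a - e} with hO
    have hOo : IsOpen O := C.isOpen_dom.inter (isOpen_lt hgc continuous_const)
    have hz₀O : z₀ ∈ O := ⟨hzd, by show D.f z₀ < Γ.a - e; rw [hz₀]; linarith⟩
    have hcurve : ContMDiffOn (𝓡∂ (n + 1)) (𝓡∂ (n + 1)) ∞ (fun z => C.curve z e) C.dom := by
      have h := Γ.contMDiffOn_curve _ hy
      have h2 : ContMDiffOn (𝓡∂ (n + 1)) ((𝓡∂ (n + 1)).prod 𝓘(ℝ, ℝ)) ∞ (fun z : c.W => (z, e)) C.dom :=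
        contMDiffOn_id.prodMk contMDiffOn_const
      exact h.comp h2 fun z hz => Set.mk_mem_prod hz ⟨he0.le, hεbox⟩
    have hca : ContMDiffAt (𝓡∂ (n + 1)) (𝓡∂ (n + 1)) ∞ (fun z => C.curve z e) z₀ :=
      (hcurve z₀ hzd).contMDiffAt (C.isOpen_dom.mem_nhds hzd)
    refine hca.congr_of_eventuallyEq ?_
    filter_upwards [hOo.mem_nhds hz₀O] with z hz
    have hz2 : D.f z < Γ.a - e := hz.2
    have hza : D.f z ≤ Γ.a := by linarith
    exact Γ.Fl_eq_of_mem_dom hy hza hz.1 ⟨by linarith [D.f_nonneg z], hea.le⟩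
  have hsm_ret : ∀ w : c.W, f w = ε → ContMDiffAt (𝓡∂ (n + 1)) (𝓡∂ (n + 1)) ∞ Γ.ret w := by
    intro w₀ hw₀
    have hw₀e : D.f w₀ = e := hg_lev w₀ hw₀
    have hw₀a : D.f w₀ ≤ Γ.a := by rw [hw₀e]; exact hea.le
    obtain ⟨hy, hwd⟩ := Γ.centre_spec hw₀a
    set C := Γ.bx (Γ.centre w₀) hy with hC
    have hεbox : e < C.box.ε := hea.trans_le (Γ.a_le_ε _ hy)
    set O : Set c.W := C.dom ∩ {z | D.f z < Γ.a} with hO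
    have hOo : IsOpen O := C.isOpen_dom.inter (isOpen_lt hgc continuous_const)
    have hw₀O : w₀ ∈ O := ⟨hwd, by show D.f w₀ < Γ.a; rw [hw₀e]; exact hea⟩
    have hcurve : ContMDiffOn (𝓡∂ (n + 1)) (𝓡∂ (n + 1)) ∞ (fun z => C.curve z (-D.f z))
        (C.dom ∩ {z | D.f z < C.box.ε}) := Γ.contMDiffOn_curve_neg _ hy
    have hO' : O ⊆ C.dom ∩ {z | D.f z < C.box.ε} := fun z hz =>
      ⟨hz.1, lt_of_lt_of_le (show D.f z < Γ.a from hz.2) (Γ.a_le_ε _ hy)⟩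
    have hca : ContMDiffAt (𝓡∂ (n + 1)) (𝓡∂ (n + 1)) ∞ (fun z => C.curve z (-D.f z)) w₀ :=
      (hcurve w₀ (hO' hw₀O)).contMDiffAt ((C.isOpen_dom.inter (isOpen_lt hgc continuous_const)).mem_nhds
        (hO' hw₀O))
    refine hca.congr_of_eventuallyEq ?_
    filter_upwards [hOo.mem_nhds hw₀O] with z hz
    have hza : D.f z ≤ Γ.a := (show D.f z < Γ.a from hz.2).le
    exact Γ.Fl_eq_of_mem_dom hy hza hz.1 ⟨le_rfl, by linarith [D.f_nonneg z]⟩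
  ----------------------------------------------------------------------------------------------
  -- the two maps `M → V`, `V → M`
  ----------------------------------------------------------------------------------------------
  set eι := hι.isEmbedding.toHomeomorph with heι
  set einl := c.isSmoothEmbedding_inl.isEmbedding.toHomeomorph with heinl
  have hmemV : ∀ x, Γ.Fl (c.inl x) e ∈ range ι := fun x => by
    rw [hrange]; exact hFl_lev x
  have hmemM : ∀ v : V, Γ.ret (ι v) ∈ range c.inl := fun v =>
    hret_mem (ι v) (by have : ι v ∈ f ⁻¹' {ε} := hrange ▸ mem_range_self v; exact this)
  set φ : M → V := fun x => eι.symm ⟨Γ.Fl (c.inl x) e, hmemV x⟩ with hφ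
  set ψ : V → M := fun v => einl.symm ⟨Γ.ret (ι v), hmemM v⟩ with hψ
  have hιφ : ∀ x, ι (φ x) = Γ.Fl (c.inl x) e := fun x => by
    have h := eι.apply_symm_apply ⟨Γ.Fl (c.inl x) e, hmemV x⟩
    exact congrArg Subtype.val h
  have hinlψ : ∀ v, c.inl (ψ v) = Γ.ret (ι v) := fun v => by
    have h := einl.apply_symm_apply ⟨Γ.ret (ι v), hmemM v⟩
    exact congrArg Subtype.val h
  have hfι : ∀ v : V, f (ι v) = ε := fun v => by
    have : ι v ∈ f ⁻¹' {ε} := hrange ▸ mem_range_self v; exact this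
  -- mutually inverse
  have hψφ : ∀ x, ψ (φ x) = x := fun x => by
    apply c.isSmoothEmbedding_inl.isEmbedding.injective
    rw [hinlψ, hιφ]
    have hg_range : D.f (c.inl x) = 0 := hg_inl x
    exact Γ.ret_Fl hg_range ⟨he0.le, hea.le⟩
  have hφψ : ∀ v, φ (ψ v) = v := fun v => by
    apply hι.isEmbedding.injective
    rw [hιφ, hinlψ]
    have hw : f (ι v) = ε := hfι v
    have h := Γ.Fl_ret (z := ι v) (by rw [hg_lev _ hw]; exact hea.le)
    rwa [hg_lev _ hw] at h
  -- smooth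
  have hφs : ContMDiff (𝓡 n) (𝓡 n) ∞ φ := by
    have h1 : ContMDiffOn (𝓡 n) (𝓡∂ (n + 1)) ∞ (fun x => Γ.Fl (c.inl x) e) univ := fun x _ =>
      ((hsm_Fl x).comp x (c.isSmoothEmbedding_inl.isImmersion.contMDiff x)).contMDiffWithinAt
    have h2 := contMDiffOn_of_comp_eq_of_isSmoothEmbedding hι isOpen_univ h1 fun x _ => hιφ x
    exact fun x => (h2 x (mem_univ x)).contMDiffAt univ_mem
  have hψs : ContMDiff (𝓡 n) (𝓡 n) ∞ ψ := by
    have h1 : ContMDiffOn (𝓡 n) (𝓡∂ (n + 1)) ∞ (fun v => Γ.ret (ι v)) univ := fun v _ =>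
      ((hsm_ret (ι v) (hfι v)).comp v (hι.isImmersion.contMDiff v)).contMDiffWithinAt
    have h2 := contMDiffOn_of_comp_eq_of_isSmoothEmbedding c.isSmoothEmbedding_inl isOpen_univ h1
      fun v _ => hinlψ v
    exact fun v => (h2 v (mem_univ v)).contMDiffAt univ_mem
  let Φ : M ≃ₘ⟮𝓡 n, 𝓡 n⟯ V :=
    { toFun := φ, invFun := ψ, left_inv := hψφ, right_inv := hφψ, contMDiff_toFun := hφs, contMDiff_invFun := hψs }
  ----------------------------------------------------------------------------------------------
  -- the homotopy `(s, x) ↦ Fl (inl x) (s e)` from `inl` to `ι ∘ φ`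
  ----------------------------------------------------------------------------------------------
  have hHc : Continuous fun p : unitInterval × M => Γ.Fl (c.inl p.2) ((p.1 : ℝ) * e) := by
    rw [continuous_iff_continuousAt]
    rintro ⟨s₀, x₀⟩
    set z₀ := c.inl x₀ with hz₀def
    have hz₀ : D.f z₀ = 0 := hg_inl x₀
    have hz₀a : D.f z₀ ≤ Γ.a := by rw [hz₀]; exact ha.le
    obtain ⟨hy, hzd⟩ := Γ.centre_spec hz₀a
    set C := Γ.bx (Γ.centre z₀) hy with hC
    have hεbox : e ≤ C.box.ε := hea.le.trans (Γ.a_le_ε _ hy)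
    -- on `I × inl⁻¹(dom)` the map is the box curve
    have hO : IsOpen ((univ : Set unitInterval) ×ˢ (c.inl ⁻¹' C.dom)) :=
      isOpen_univ.prod (C.isOpen_dom.preimage c.isSmoothEmbedding_inl.isEmbedding.continuous)
    have hmem : (s₀, x₀) ∈ (univ : Set unitInterval) ×ˢ (c.inl ⁻¹' C.dom) := ⟨mem_univ _, hzd⟩
    have hcurve := Γ.contMDiffOn_curve _ hy
    have hse : ∀ p : unitInterval × M, (p.1 : ℝ) * e ∈ Icc 0 e := fun p =>
      ⟨mul_nonneg p.1.2.1 he0.le, by nlinarith [p.1.2.2, he0.le]⟩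
    have hι2 : Continuous fun p : unitInterval × M => (c.inl p.2, (p.1 : ℝ) * e) :=
      (c.isSmoothEmbedding_inl.isEmbedding.continuous.comp continuous_snd).prodMk
        ((continuous_subtype_val.comp continuous_fst).mul continuous_const)
    have hmaps : MapsTo (fun p : unitInterval × M => (c.inl p.2, (p.1 : ℝ) * e))
        ((univ : Set unitInterval) ×ˢ (c.inl ⁻¹' C.dom)) (C.dom ×ˢ Icc 0 C.box.ε) := fun p hp =>
      Set.mk_mem_prod hp.2 ⟨(hse p).1, (hse p).2.trans hεbox⟩
    have hcc : ContinuousOn (fun p : c.W × ℝ => C.curve p.1 p.2) (C.dom ×ˢ Icc 0 C.box.ε) := hcurve.continuousOn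
    have hcont : ContinuousOn ((fun p : c.W × ℝ => C.curve p.1 p.2) ∘ fun p : unitInterval × M => (c.inl p.2, (p.1 : ℝ) * e))
        ((univ : Set unitInterval) ×ˢ (c.inl ⁻¹' C.dom)) :=
      hcc.comp hι2.continuousOn hmaps
    have heq : EqOn (fun p : unitInterval × M => Γ.Fl (c.inl p.2) ((p.1 : ℝ) * e))
        ((fun p : c.W × ℝ => C.curve p.1 p.2) ∘ fun p : unitInterval × M => (c.inl p.2, (p.1 : ℝ) * e))
        ((univ : Set unitInterval) ×ˢ (c.inl ⁻¹' C.dom)) := by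
      intro p hp
      change Γ.Fl (c.inl p.2) ((p.1 : ℝ) * e) = C.curve (c.inl p.2) ((p.1 : ℝ) * e)
      have hza : D.f (c.inl p.2) ≤ Γ.a := by rw [hg_inl]; exact ha.le
      refine Γ.Fl_eq_of_mem_dom hy hza hp.2 ⟨?_, (hse p).2.trans hea.le⟩
      rw [hg_inl, neg_zero]; exact (hse p).1
    exact ((hcont.congr heq).continuousAt (hO.mem_nhds hmem))
  refine ⟨Φ, ⟨{ toFun := fun p => Γ.Fl (c.inl p.2) ((p.1 : ℝ) * e),
                 continuous_toFun := hHc,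
                 map_zero_left := fun x => ?_,
                 map_one_left := fun x => ?_ }⟩⟩
  · change Γ.Fl (c.inl x) (((0 : unitInterval) : ℝ) * e) = c.inl x
    rw [show ((0 : unitInterval) : ℝ) = 0 from rfl, zero_mul]
    exact Γ.Fl_zero (by rw [hg_inl]; exact ha.le)
  · change Γ.Fl (c.inl x) (((1 : unitInterval) : ℝ) * e) = ι (φ x)
    rw [show ((1 : unitInterval) : ℝ) = 1 from rfl, one_mul, hιφ]

end Cobordism

end Literature.Topology.FourManifolds
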